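import Summits.QuantumFields.BalabanUV.T4Continuum.Support.NE7SliceLetterGaugeObstruction
import Summits.QuantumFields.BalabanUV.T4Continuum.Support.SkeletonLattice
import HarnessLib

/-!
# NE7GaugeModeAllowance — THE MATCHING UPPER BOUND TO F128's OBSTRUCTION: for a residual gauge mode `X = gaugeDir W ξ` (`ξ = 0` on the corner lattice `Mℤ^d`) at a unitary background of
# plaquette radius `x`, `‖ξ‖_∞ ≤ d(M−1)·‖X‖_∞` (telescoping from the corner of the block; `Ad` is isometric) and hence `‖curl_W X(p)‖ = ‖ξ − Ad_{hol(∂p)}ξ‖ ≤ 2x·d(M−1)·‖X‖_∞` — the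
# HOMOGENEOUS TWO-TERM slice-solver letter holds ON PURE GAUGE MODES with `K_G = 0` and allowance slope `K_X = 2d(M−1)·x ≍ 2d·b∕M` (file 62 of the curved (APE))

Cell `pub-balaban`, rung (B)+1 sub-cell t4, lineage `b2b-balaban-t4-ne7-p1` (CRUX PROVER NE7 #1 = OWNER of row NE7), generation 80; memo
`t4/b2b-balaban-t4-ne7-p1-g80/SLICE-LETTER-OBSTRUCTION.md` §3 (iii).  File F132, over row NE3's `NE3CurlOfGaugeDir.norm_curlAt_gaugeDir_le` (`‖curl_W(gaugeDir W ζ)(p)‖ ≤ 2a‖ζ(z)‖`),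
`AveragingDeficitTransport.norm_Ad_of_unitary`, `SkeletonLattice.cmod ∕ cdiv` (block coordinates).
WHY.  F128 showed that any slice-solver letter valid on a set containing the W-tangent gauge modes must carry a `g`-independent allowance `≥ ‖ζ − Ad_{hol}ζ‖` (`≍ x·‖ζ‖` for a bump of
height `ζ`), so the repaired letter (F131, memo §3) is two-term.  Scaling `X ↦ tX` shows the allowance must be HOMOGENEOUS in `X`: `‖curlAt W X‖ ≤ K_G·g + K_X·‖X‖_∞`.  THIS file computes
the slope `K_X` ON THE PURE GAUGE MODES themselves, where the functional term is absent (`g = 0` at a globally critical `W`, F127): the only input is the 0-form sup shape for fields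
vanishing on the corner lattice — every site is reached from the corner `M•⌊y∕M⌋` of its block by a monotone lattice path of length `Σ_i (y_i mod M) ≤ d(M−1)`, and along a bond
`‖ξ(y+e_κ)‖ ≤ ‖ξ(y)‖ + ‖X(y,κ)‖` (`X(y,κ) = Ad_{W(y,κ)⁻¹}ξ(y) − ξ(y+e_κ)`, `Ad` isometric).  So `K_X = 2x·d(M−1)`: with `x = b∕M²` the slope is `2d·b∕M` — level-free small over `M`,
the closing order of g79 §1; and F128's lower bound `≍ x` is attained by bumps (sharp up to the Poincaré factor `dM`).  What remains OPEN is the slope on the NON-gauge (Landau) part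
of a tangent field and the mixed term — the propagator content (memo §3 (iv)).
WHAT ([folklore]; 0 def, 0 sorry).  §1 `norm_step_le` (one bond), `norm_line_le` (a segment in one direction), `norm_path_le` (a monotone multi-direction path: Finset induction);
§2 **`norm_le_of_vanish_corners`** — `ξ(M•w) = 0 ∀ w`, `W` unitary ⟹ `‖ξ y‖ ≤ d(M−1)·sup‖gaugeDir W ξ‖`; §3 **`curl_gaugeMode_le`** — `‖curlAt W (gaugeDir W ξ) z μ ν‖ ≤ 2x·d(M−1)·sup‖gaugeDir W ξ‖`
(`μ ≠ ν`, `SmallField W x`); §4 **`twoTerm_on_gaugeModes`** — the homogeneous two-term letter on `{gaugeDir W ξ : ξ skew periodic, 0 on corners}` with `K_G = 0`, `K_X = 2x·d(M−1)`,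
for EVERY `g ≥ 0` (the functional hypothesis is not even used).
HONEST FRAMING (page 1): elementary lattice bookkeeping at one configuration; nothing of Bałaban's asserted; the slice solver on the Landau part is NOT touched; NOT ONE-STEP, NOT NE7;
spine 0∕9; finite T⁴ rung (B)+1 — NOT infinite volume, NOT mass gap, NOT `BetaPertH`, NOT Clay.  Continuum YM on T⁴ ⇐ BetaPertH ∧ nine spine estimates (0/9 proved); BetaPertH ⇐
(D1) ∧ (D4) ∧ CAP+tail; G-an2-4 gates asym, D1 and NE2/3/4.
-/

set_option autoImplicit false

open scoped BigOperators Matrix.Norms.L2Operator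
open NormedSpace Finset

namespace Summit.QuantumFields.BalabanUV.T4Continuum.NE7GaugeModeAllowance

open Literature.MathematicalPhysics.QuantumFieldTheory.Balaban1983to89
open B7Prop1Explicit B7Prop2Explicit UnitaryModel
open T4AveragingDeficitWall (Ad IsUnitaryCfg IsSkewDir SmallField curlAt dirL1)
open T4AveragingDeficitWallBoundary (IsPeriodicCfg periodBox)
open AveragingDeficitPeriodicCounting (IsPeriodicDir)
open MinimalActionLevels (perWin)
open BlockAveragePushDirGauge (gaugeDir)
open NE3HessForm (hess)
open NE3TangentCovariantTower (dirIter)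
open NE3CurlOfGaugeDir (norm_curlAt_gaugeDir_le)
open AveragingDeficitTransport (norm_Ad_of_unitary)
open SkeletonLattice (cmod cdiv smul_cdiv_add_cmod cmod_nonneg cmod_lt)

noncomputable section

variable {d : ℕ} {n : Type*} [Fintype n] [DecidableEq n]

/-! ## §1 Telescoping along lattice paths -/

section Tele

variable {W : Site d → Fin d → (Matrix n n ℂ)ˣ} (hW : IsUnitaryCfg W) (ξ : Site d → Matrix n n ℂ) {G : ℝ}
  (hG : ∀ (y : Site d) (κ : Fin d), ‖gaugeDir W ξ y κ‖ ≤ G)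
include hW hG

/-- One bond: `‖ξ(y + e_κ)‖ ≤ ‖ξ(y)‖ + G`. [folklore] -/
theorem norm_step_le (y : Site d) (κ : Fin d) : ‖ξ (y + e κ)‖ ≤ ‖ξ y‖ + G := by
  have h := hG y κ
  have hAd : ‖Ad (W y κ)⁻¹ (ξ y)‖ = ‖ξ y‖ := norm_Ad_of_unitary ((unitaryUnits _).inv_mem (hW y κ)) _
  have heq : ξ (y + e κ) = Ad (W y κ)⁻¹ (ξ y) - gaugeDir W ξ y κ := by simp only [gaugeDir, sub_sub_cancel]
  rw [heq]
  calc ‖Ad (W y κ)⁻¹ (ξ y) - gaugeDir W ξ y κ‖ ≤ ‖Ad (W y κ)⁻¹ (ξ y)‖ + ‖gaugeDir W ξ y κ‖ := norm_sub_le _ _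
    _ ≤ ‖ξ y‖ + G := by rw [hAd]; exact add_le_add le_rfl h

/-- A segment in one direction: `‖ξ(y + m•e_κ)‖ ≤ ‖ξ(y)‖ + m·G`. [folklore] -/
theorem norm_line_le (y : Site d) (κ : Fin d) : ∀ m : ℕ, ‖ξ (y + (m : ℤ) • e κ)‖ ≤ ‖ξ y‖ + m * G
  | 0 => by simp
  | m + 1 => by
      have ih := norm_line_le y κ m
      have hs := norm_step_le hW ξ hG (y + (m : ℤ) • e κ) κ
      have heq : y + ((m + 1 : ℕ) : ℤ) • e κ = y + (m : ℤ) • e κ + e κ := by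
        rw [Nat.cast_succ, add_smul, one_smul, add_assoc]
      rw [heq]
      calc ‖ξ (y + (m : ℤ) • e κ + e κ)‖ ≤ ‖ξ (y + (m : ℤ) • e κ)‖ + G := hs
        _ ≤ ‖ξ y‖ + m * G + G := add_le_add ih le_rfl
        _ = ‖ξ y‖ + ((m + 1 : ℕ) : ℝ) * G := by push_cast; ring

/-- A monotone multi-direction path: `‖ξ(y + Σ_{i∈s} r_i•e_i)‖ ≤ ‖ξ(y)‖ + (Σ_{i∈s} r_i)·G`. [folklore] -/
theorem norm_path_le (y : Site d) (r : Fin d → ℕ) (s : Finset (Fin d)) :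
    ‖ξ (y + ∑ i ∈ s, ((r i : ℕ) : ℤ) • e i)‖ ≤ ‖ξ y‖ + (∑ i ∈ s, (r i : ℝ)) * G := by
  classical
  induction s using Finset.induction_on with
  | empty => simp
  | insert i s hi ih =>
      rw [Finset.sum_insert hi, Finset.sum_insert hi, add_comm (((r i : ℕ) : ℤ) • e i), ← add_assoc]
      have h := norm_line_le hW ξ hG (y + ∑ j ∈ s, ((r j : ℕ) : ℤ) • e j) i (r i)
      calc ‖ξ (y + ∑ j ∈ s, ((r j : ℕ) : ℤ) • e j + ((r i : ℕ) : ℤ) • e i)‖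
          ≤ ‖ξ (y + ∑ j ∈ s, ((r j : ℕ) : ℤ) • e j)‖ + (r i) * G := h
        _ ≤ ‖ξ y‖ + (∑ j ∈ s, (r j : ℝ)) * G + (r i) * G := add_le_add ih le_rfl
        _ = ‖ξ y‖ + ((r i : ℝ) + ∑ j ∈ s, (r j : ℝ)) * G := by ring

end Tele

/-! ## §2 The sup shape of a 0-form vanishing on the corner lattice -/

omit [Fintype n] [DecidableEq n] in
/-- Block coordinates: `y = M•⌊y∕M⌋ + Σ_i (y_i mod M)•e_i` with `0 ≤ y_i mod M ≤ M − 1`. [folklore] -/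
theorem site_eq_corner_add_sum {M : ℕ} (hM : 1 ≤ M) (y : Site d) :
    ∃ r : Fin d → ℕ, (∀ i, r i ≤ M - 1) ∧ y = (M : ℤ) • cdiv M y + ∑ i : Fin d, ((r i : ℕ) : ℤ) • e i := by
  refine ⟨fun i => (cmod M y i).toNat, fun i => ?_, ?_⟩
  · have h1 := cmod_lt hM y i
    have h0 := cmod_nonneg hM y i
    have : (((cmod M y i).toNat : ℕ) : ℤ) < (M : ℤ) := by rw [Int.toNat_of_nonneg h0]; exact h1
    show (cmod M y i).toNat ≤ M - 1
    omega
  · have hsum : (∑ i : Fin d, (((cmod M y i).toNat : ℕ) : ℤ) • (e i : Site d)) = cmod M y := by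
      funext k
      rw [Finset.sum_apply, Finset.sum_eq_single k]
      · simp only [Pi.smul_apply, B7Prop1Explicit.e, Pi.single_eq_same, smul_eq_mul, mul_one]
        exact Int.toNat_of_nonneg (cmod_nonneg hM y k)
      · intro i _ hik
        simp only [Pi.smul_apply, B7Prop1Explicit.e, Pi.single_eq_of_ne (Ne.symm hik), smul_eq_mul, mul_zero]
      · intro hk; exact absurd (Finset.mem_univ k) hk
    rw [hsum, smul_cdiv_add_cmod]

/-- **THE SUP SHAPE OF A 0-FORM VANISHING ON THE CORNER LATTICE**: `W` unitary, `ξ(M•w) = 0` for all `w`, `‖gaugeDir W ξ‖ ≤ G` everywhere ⟹ `‖ξ(y)‖ ≤ d(M−1)·G` for every `y`. [folklore] -/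
theorem norm_le_of_vanish_corners {W : Site d → Fin d → (Matrix n n ℂ)ˣ} (hW : IsUnitaryCfg W) {M : ℕ} (hM : 1 ≤ M)
    (ξ : Site d → Matrix n n ℂ) (hξc : ∀ w : Site d, ξ ((M : ℤ) • w) = 0) {G : ℝ} (hG : ∀ (y : Site d) (κ : Fin d), ‖gaugeDir W ξ y κ‖ ≤ G)
    (y : Site d) : ‖ξ y‖ ≤ (d : ℝ) * ((M : ℝ) - 1) * G := by
  classical
  obtain ⟨r, hr, hy⟩ := site_eq_corner_add_sum hM y
  have hpath := norm_path_le hW ξ hG ((M : ℤ) • cdiv M y) r Finset.univ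
  rw [← hy, hξc, norm_zero, zero_add] at hpath
  refine hpath.trans ?_
  have hsum : (∑ i : Fin d, (r i : ℝ)) ≤ (d : ℝ) * ((M : ℝ) - 1) := by
    have hM1 : ((M - 1 : ℕ) : ℝ) = (M : ℝ) - 1 := by rw [Nat.cast_sub hM, Nat.cast_one]
    calc (∑ i : Fin d, (r i : ℝ)) ≤ ∑ _i : Fin d, ((M : ℝ) - 1) :=
          Finset.sum_le_sum fun i _ => by rw [← hM1]; exact_mod_cast hr i
      _ = (d : ℝ) * ((M : ℝ) - 1) := by rw [Finset.sum_const, Finset.card_univ, Fintype.card_fin, nsmul_eq_mul]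
  rcases Nat.eq_zero_or_pos d with hd | hd
  · subst hd
    simp
  · have hG0 : 0 ≤ G := (norm_nonneg _).trans (hG y ⟨0, hd⟩)
    exact mul_le_mul_of_nonneg_right hsum hG0

/-! ## §3 The curl of a residual gauge mode is controlled by its own sup, with slope `2x·d(M−1)` -/

/-- **THE ALLOWANCE SLOPE ON PURE GAUGE MODES**: `W` unitary with `SmallField W x`, `ξ(M•w) = 0` for all `w`, `‖gaugeDir W ξ‖ ≤ G` ⟹ on every plane `μ ≠ ν`,
`‖curlAt W (gaugeDir W ξ) z μ ν‖ ≤ 2x·(d(M−1)·G)` — the residual gauge mode's curl is its own sup times `2d(M−1)·x ≍ 2d·b∕M`. [folklore] -/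
theorem curl_gaugeMode_le [Nonempty n] {W : Site d → Fin d → (Matrix n n ℂ)ˣ} (hW : IsUnitaryCfg W) {x : ℝ} (hWx : SmallField W x) {M : ℕ} (hM : 1 ≤ M)
    (ξ : Site d → Matrix n n ℂ) (hξc : ∀ w : Site d, ξ ((M : ℤ) • w) = 0) {G : ℝ} (hG : ∀ (y : Site d) (κ : Fin d), ‖gaugeDir W ξ y κ‖ ≤ G)
    (z : Site d) {μ ν : Fin d} (hμν : μ ≠ ν) :
    ‖curlAt W (gaugeDir W ξ) z μ ν‖ ≤ 2 * x * ((d : ℝ) * ((M : ℝ) - 1) * G) := by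
  have hx0 : 0 ≤ x := le_trans (norm_nonneg _) (hWx z μ ν hμν)
  calc ‖curlAt W (gaugeDir W ξ) z μ ν‖ ≤ 2 * x * ‖ξ z‖ := norm_curlAt_gaugeDir_le hW hWx ξ z hμν
    _ ≤ 2 * x * ((d : ℝ) * ((M : ℝ) - 1) * G) := mul_le_mul_of_nonneg_left (norm_le_of_vanish_corners hW hM ξ hξc hG z) (by positivity)

/-! ## §4 The homogeneous two-term letter holds on the residual gauge modes, with `K_G = 0` -/

/-- **THE HOMOGENEOUS TWO-TERM LETTER ON PURE GAUGE MODES** (`L ≥ 1`, any `N`, `j`, `M = L^{j+1}`): for every skew periodic `ξ` vanishing on the corner lattice `Mℤ^d`, the field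
`X = gaugeDir W ξ` satisfies, for every `g ≥ 0` and every sup bound `R` of `X`, `‖curlAt W X z μ ν‖ ≤ 0·g + (2x·d(M−1))·R` — F128's necessary allowance is also SUFFICIENT on the
gauge modes, with slope `2d(M−1)·x`; the functional hypothesis is not used. [folklore] -/
theorem twoTerm_on_gaugeModes [Nonempty n] {L : ℕ} (hL : 1 ≤ L) (j : ℕ) {W : Site d → Fin d → (Matrix n n ℂ)ˣ} (hW : IsUnitaryCfg W) {x : ℝ} (hWx : SmallField W x)
    {ξ : Site d → Matrix n n ℂ} (hξc : ∀ w : Site d, ξ (((L : ℤ) ^ (j + 1)) • w) = 0)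
    {R : ℝ} (hR : ∀ (y : Site d) (κ : Fin d), ‖gaugeDir W ξ y κ‖ ≤ R) (g : ℝ)
    (z : Site d) {μ ν : Fin d} (hμν : μ ≠ ν) :
    ‖curlAt W (gaugeDir W ξ) z μ ν‖ ≤ 0 * g + (2 * x * ((d : ℝ) * (((L : ℝ) ^ (j + 1)) - 1))) * R := by
  have hM : 1 ≤ L ^ (j + 1) := Nat.one_le_pow _ _ hL
  have hξc' : ∀ w : Site d, ξ (((L ^ (j + 1) : ℕ) : ℤ) • w) = 0 := fun w => by
    have h := hξc w; push_cast at h ⊢; exact h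
  have h := curl_gaugeMode_le hW hWx hM ξ hξc' hR z hμν
  rw [zero_mul, zero_add]
  calc ‖curlAt W (gaugeDir W ξ) z μ ν‖ ≤ 2 * x * ((d : ℝ) * (((L ^ (j + 1) : ℕ) : ℝ) - 1) * R) := h
    _ = (2 * x * ((d : ℝ) * (((L : ℝ) ^ (j + 1)) - 1))) * R := by push_cast; ring

end

end Summit.QuantumFields.BalabanUV.T4Continuum.NE7GaugeModeAllowance
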